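import Summits.QuantumFields.GaugeBoot.PolynomialOrbitAveraging
import Summits.QuantumFields.GaugeBoot.CentralLoopEquationsZd
import HarnessLib

/-!
# Gauge averages of polynomial observables are polynomial: actions of local linear form (gauge-boot, L1 supplement)

HONEST FRAMING (cell `pub-gaugeboot`, page 1 of every file): the venture produces certified bounds
on lattice expectations at stated coupling, gauge group, dimension and torus size; NOT a mass gap,
NOT a continuum limit, NOT a string tension; NOT Yang–Mills-summit-bearing (barriers
`FixedCouplingUltralocality`, `PerturbativeInvisibility`). This module is a structural statement
about lattice gauge measures at stated coupling; it certifies no number.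

## Content

An action of `H` on `ι → G` of LOCAL LINEAR FORM `(act h U)_e = a(h,e) · U_e · b(h,e)` — the gauge
actions of the torus and of `ℤ^d` (`a = h(x)`, `b = h(x+eᵢ)⁻¹`) — maps each generator
`Re/Im ρ(U_e)_{cd}` of the polynomial algebra (`PolynomialObservables`) into the span of the
generators at the same link: a left and a right one-link multiplication (`reEntry_comp_shiftCM` of
`PolynomialObservables`, `reEntry_comp_rightShiftCM` here; `span_linkGens_map_shiftCM_le`,
`span_linkGens_map_rightShiftCM_le`). This is the hypothesis `hgen` of
`PolynomialOrbitAveraging.lean` (`exists_fg_invariant_of_local`), whence: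

* ★★ `orbitAverage_gaugeTransform_mem_polyFunctions` (torus `(ℤ/L)^d`) and
  ★★ `orbitAverage_gaugeTransformZd_mem_polyFunctions` (`ℤ^d`) — THE GAUGE AVERAGE
  `U ↦ ∫ f(U^g) dg` OF A POLYNOMIAL OBSERVABLE IS A POLYNOMIAL OBSERVABLE (any compact `G`, any
  faithful unitary `r`; `dg` = Haar measure of the compact gauge group `sites → G`).

The sequel `AbelianPolynomialLoopEquations.lean` concludes: for `U(1)` the loop equations with
gauge-invariant POLYNOMIAL test functions plus realisability determine the gauge-invariant sector.

References: Z. Li, S. Zhou, arXiv:2404.17071 §2, §4 (the question, numerically); P. Anderson,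
M. Kruczenski, Nucl. Phys. B 921 (2017) §2. Folklore.
-/

noncomputable section

open MeasureTheory
open Literature.MathematicalPhysics.QuantumFieldTheory (haarProbability LatticeRep)

namespace Summit.QuantumFields.GaugeBoot

/-! ## Right one-link shifts and the span of the generators at a link -/

section LinkSpan

variable {ι : Type*} [DecidableEq ι] {G : Type*} [Group G] [TopologicalSpace G] [ContinuousMul G]
  (r : LatticeRep G)

/-- The one-link RIGHT shift `U ↦ U[e ↦ U_e g]` as a continuous self-map. [folklore] -/
def rightShiftCM (e : ι) (g : G) : C(ι → G, ι → G) where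
  toFun U := Function.update U e (U e * g)
  continuous_toFun := continuous_id.update e ((continuous_apply e).mul continuous_const)

/-- `rightShiftCM` evaluated. -/
@[simp] theorem rightShiftCM_apply (e : ι) (g : G) (U : ι → G) :
    rightShiftCM e g U = Function.update U e (U e * g) := rfl

/-- `Re (ρ(U_e)ρ(g))_{ab} = Σ_d (Re ρ(g)_{db} Re ρ(U_e)_{ad} - Im ρ(g)_{db} Im ρ(U_e)_{ad})`. [folklore] -/
theorem reEntry_comp_rightShiftCM (e : ι) (a b : Fin r.N) (g : G) :
    (reEntry r e a b).comp (rightShiftCM e g) =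
      ∑ d, ((r.ρ g d b).re • reEntry r e a d - (r.ρ g d b).im • imEntry r e a d) := by
  ext U
  simp [Matrix.mul_apply, Complex.re_sum, Complex.mul_re, ContinuousMap.coe_sum, Finset.sum_apply,
    mul_comm]

/-- `Im (ρ(U_e)ρ(g))_{ab} = Σ_d (Re ρ(g)_{db} Im ρ(U_e)_{ad} + Im ρ(g)_{db} Re ρ(U_e)_{ad})`. [folklore] -/
theorem imEntry_comp_rightShiftCM (e : ι) (a b : Fin r.N) (g : G) :
    (imEntry r e a b).comp (rightShiftCM e g) =
      ∑ d, ((r.ρ g d b).re • imEntry r e a d + (r.ρ g d b).im • reEntry r e a d) := by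
  ext U
  simp [Matrix.mul_apply, Complex.im_sum, Complex.mul_im, ContinuousMap.coe_sum, Finset.sum_apply,
    mul_comm]

/-- The generators AT THE LINK `e` together with `1`: a finite set spanning an affine-linear
finite-dimensional subspace of the polynomial algebra containing `Re/Im ρ(U_e)_{ab}`. [folklore] -/
def linkGens (e : ι) : Set C(ι → G, ℝ) :=
  insert 1 (Set.range (fun p : Fin r.N × Fin r.N => reEntry r e p.1 p.2) ∪
    Set.range (fun p : Fin r.N × Fin r.N => imEntry r e p.1 p.2))

omit [DecidableEq ι] [ContinuousMul G] in
/-- `linkGens` is finite. -/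
theorem linkGens_finite (e : ι) : (linkGens (ι := ι) r e).Finite :=
  ((Set.finite_range _).union (Set.finite_range _)).insert 1

omit [DecidableEq ι] [ContinuousMul G] in
/-- `linkGens ⊆ polyAlgebra`. -/
theorem span_linkGens_le (e : ι) :
    Submodule.span ℝ (linkGens (ι := ι) r e) ≤ Subalgebra.toSubmodule (polyAlgebra (ι := ι) r) := by
  refine Submodule.span_le.2 ?_
  rintro v (rfl | ⟨p, rfl⟩ | ⟨p, rfl⟩)
  · exact Subalgebra.one_mem _
  · exact reEntry_mem r e p.1 p.2
  · exact imEntry_mem r e p.1 p.2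

omit [DecidableEq ι] [ContinuousMul G] in
/-- `Re ρ(U_e)_{ab} ∈ span (linkGens e)`. -/
theorem reEntry_mem_span_linkGens (e : ι) (a b : Fin r.N) :
    reEntry r e a b ∈ Submodule.span ℝ (linkGens (ι := ι) r e) :=
  Submodule.subset_span (Set.mem_insert_of_mem _ (Or.inl ⟨(a, b), rfl⟩))

omit [DecidableEq ι] [ContinuousMul G] in
/-- `Im ρ(U_e)_{ab} ∈ span (linkGens e)`. -/
theorem imEntry_mem_span_linkGens (e : ι) (a b : Fin r.N) :
    imEntry r e a b ∈ Submodule.span ℝ (linkGens (ι := ι) r e) :=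
  Submodule.subset_span (Set.mem_insert_of_mem _ (Or.inr ⟨(a, b), rfl⟩))

omit [DecidableEq ι] [Group G] [ContinuousMul G] in
/-- A linear self-map of `C(ι → G, ℝ)` sending the generators of a span into the span maps the span
into itself. [folklore] -/
theorem map_span_le_span {S : Set C(ι → G, ℝ)} (φ : C(ι → G, ℝ) →ₗ[ℝ] C(ι → G, ℝ))
    (h : ∀ s ∈ S, φ s ∈ Submodule.span ℝ S) :
    (Submodule.span ℝ S).map φ ≤ Submodule.span ℝ S := by
  rw [Submodule.map_span]
  refine Submodule.span_le.2 ?_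
  rintro _ ⟨s, hs, rfl⟩
  exact h s hs

/-- **The span of the generators at `e` is stable under the LEFT shift `U ↦ U[e ↦ g U_e]`.**
[folklore] -/
theorem span_linkGens_map_shiftCM_le (e : ι) (g : G) :
    (Submodule.span ℝ (linkGens (ι := ι) r e)).map
        (ContinuousMap.compRightAlgHom ℝ ℝ (shiftCM (ι := ι) e g)).toLinearMap ≤
      Submodule.span ℝ (linkGens (ι := ι) r e) := by
  refine map_span_le_span _ ?_
  rintro v (rfl | ⟨p, rfl⟩ | ⟨p, rfl⟩)
  · exact Submodule.subset_span (Set.mem_insert _ _)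
  · change (reEntry r e p.1 p.2).comp (shiftCM e g) ∈ _
    rw [reEntry_comp_shiftCM]
    exact Submodule.sum_mem _ fun c _ => Submodule.sub_mem _
      (Submodule.smul_mem _ _ (reEntry_mem_span_linkGens r e c p.2))
      (Submodule.smul_mem _ _ (imEntry_mem_span_linkGens r e c p.2))
  · change (imEntry r e p.1 p.2).comp (shiftCM e g) ∈ _
    rw [imEntry_comp_shiftCM]
    exact Submodule.sum_mem _ fun c _ => Submodule.add_mem _
      (Submodule.smul_mem _ _ (imEntry_mem_span_linkGens r e c p.2))
      (Submodule.smul_mem _ _ (reEntry_mem_span_linkGens r e c p.2))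

/-- **The span of the generators at `e` is stable under the RIGHT shift `U ↦ U[e ↦ U_e g]`.**
[folklore] -/
theorem span_linkGens_map_rightShiftCM_le (e : ι) (g : G) :
    (Submodule.span ℝ (linkGens (ι := ι) r e)).map
        (ContinuousMap.compRightAlgHom ℝ ℝ (rightShiftCM (ι := ι) e g)).toLinearMap ≤
      Submodule.span ℝ (linkGens (ι := ι) r e) := by
  refine map_span_le_span _ ?_
  rintro v (rfl | ⟨p, rfl⟩ | ⟨p, rfl⟩)
  · exact Submodule.subset_span (Set.mem_insert _ _)
  · change (reEntry r e p.1 p.2).comp (rightShiftCM e g) ∈ _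
    rw [reEntry_comp_rightShiftCM]
    exact Submodule.sum_mem _ fun d _ => Submodule.sub_mem _
      (Submodule.smul_mem _ _ (reEntry_mem_span_linkGens r e p.1 d))
      (Submodule.smul_mem _ _ (imEntry_mem_span_linkGens r e p.1 d))
  · change (imEntry r e p.1 p.2).comp (rightShiftCM e g) ∈ _
    rw [imEntry_comp_rightShiftCM]
    exact Submodule.sum_mem _ fun d _ => Submodule.add_mem _
      (Submodule.smul_mem _ _ (imEntry_mem_span_linkGens r e p.1 d))
      (Submodule.smul_mem _ _ (reEntry_mem_span_linkGens r e p.1 d))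

end LinkSpan

/-! ## Actions of local linear form satisfy `hgen` -/

section Local

variable {H : Type*} [Group H] [TopologicalSpace H] [IsTopologicalGroup H] [CompactSpace H]
  [MeasurableSpace H] [BorelSpace H] [SecondCountableTopology H]
  {ι : Type*} [DecidableEq ι] {G : Type*} [Group G] [TopologicalSpace G] [IsTopologicalGroup G]
  [CompactSpace G] (r : LatticeRep G) {act : H → (ι → G) → (ι → G)}

omit [Group H] [IsTopologicalGroup H] [CompactSpace H] [MeasurableSpace H] [BorelSpace H]
  [SecondCountableTopology H] [CompactSpace G] in
/-- ★ **An action of local linear form `(act h U)_e = a(h,e) U_e b(h,e)` maps every generator into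
the span of the generators at the same link** — the hypothesis `hgen` of
`PolynomialOrbitAveraging.lean`, with the finite-dimensional stable subspace `span (linkGens e)`.
[folklore] -/
theorem exists_fg_invariant_of_local (hact : Continuous fun p : H × (ι → G) => act p.1 p.2)
    (a b : H → ι → G) (hloc : ∀ (h : H) (U : ι → G) (e : ι), act h U e = a h e * U e * b h e) :
    ∀ g ∈ entryGens (ι := ι) r, ∃ W : Submodule ℝ C(ι → G, ℝ), W.FG ∧
      W ≤ Subalgebra.toSubmodule (polyAlgebra (ι := ι) r) ∧ g ∈ W ∧
      ∀ h : H, W.map (ContinuousMap.compRightAlgHom ℝ ℝ (actCM act hact h)).toLinearMap ≤ W := by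
  -- the action on a function of the link `e` factors through a left and a right shift at `e`
  have hfac : ∀ (h : H) (e : ι) (v : C(ι → G, ℝ)), v ∈ Submodule.span ℝ (linkGens (ι := ι) r e) →
      v.comp (actCM act hact h) ∈ Submodule.span ℝ (linkGens (ι := ι) r e) := by
    intro h e v hv
    have key : ∀ s ∈ linkGens (ι := ι) r e, s.comp (actCM act hact h) =
        (s.comp (shiftCM (ι := ι) e (a h e))).comp (rightShiftCM (ι := ι) e (b h e)) := by
      rintro s (rfl | ⟨p, rfl⟩ | ⟨p, rfl⟩)
      · rfl
      · ext U; simp [hloc, mul_assoc]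
      · ext U; simp [hloc, mul_assoc]
    have hle : (Submodule.span ℝ (linkGens (ι := ι) r e)).map
        (ContinuousMap.compRightAlgHom ℝ ℝ (actCM act hact h)).toLinearMap ≤
        Submodule.span ℝ (linkGens (ι := ι) r e) := by
      refine map_span_le_span _ fun s hs => ?_
      change s.comp (actCM act hact h) ∈ _
      rw [key s hs]
      exact span_linkGens_map_rightShiftCM_le r e (b h e) (Submodule.mem_map_of_mem
        (span_linkGens_map_shiftCM_le r e (a h e) (Submodule.mem_map_of_mem
          (Submodule.subset_span hs))))
    exact hle (Submodule.mem_map_of_mem hv)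
  rintro g (⟨⟨e, c, d⟩, rfl⟩ | ⟨⟨e, c, d⟩, rfl⟩)
  · exact ⟨Submodule.span ℝ (linkGens (ι := ι) r e), Submodule.fg_span (linkGens_finite r e),
      span_linkGens_le r e, reEntry_mem_span_linkGens r e c d,
      fun h v hv => by
        obtain ⟨w, hw, rfl⟩ := Submodule.mem_map.1 hv
        exact hfac h e w hw⟩
  · exact ⟨Submodule.span ℝ (linkGens (ι := ι) r e), Submodule.fg_span (linkGens_finite r e),
      span_linkGens_le r e, imEntry_mem_span_linkGens r e c d,
      fun h v hv => by
        obtain ⟨w, hw, rfl⟩ := Submodule.mem_map.1 hv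
        exact hfac h e w hw⟩

end Local

/-! ## The gauge actions of the torus and of `ℤ^d` -/

section Gauge

open Literature.MathematicalPhysics.QuantumFieldTheory (Site Edge GaugeConfig gaugeTransform)
open Literature.MathematicalPhysics.QuantumLattice (LGConfig ZdEdge gaugeTransformZd)

variable {d L : ℕ} {G : Type*} [Group G] [TopologicalSpace G] [IsTopologicalGroup G]
  [CompactSpace G] [MeasurableSpace G] [BorelSpace G] [SecondCountableTopology G]
  (r : LatticeRep G)

omit [CompactSpace G] [MeasurableSpace G] [BorelSpace G] [SecondCountableTopology G] in
/-- The torus gauge action has the local linear form `(U^g)_e = g(x) U_e g(x+eᵢ)⁻¹`: every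
generator lies in a finite-dimensional gauge-stable subspace of the polynomial algebra (the
hypothesis `hgen` of `PolynomialOrbitAveraging`). [folklore] -/
theorem gaugeTransform_hgen :
    ∀ g ∈ entryGens (ι := Edge d L) r, ∃ W : Submodule ℝ C(GaugeConfig d L G, ℝ), W.FG ∧
      W ≤ Subalgebra.toSubmodule (polyAlgebra (ι := Edge d L) r) ∧ g ∈ W ∧
      ∀ h : Site d L → G, W.map (ContinuousMap.compRightAlgHom ℝ ℝ
        (actCM (gaugeTransform (d := d) (L := L) (G := G)) gaugeTransform_action.2 h)).toLinearMap
          ≤ W :=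
  exists_fg_invariant_of_local r gaugeTransform_action.2 (fun h e => h e.1)
    (fun h e => (h (e.1.shift e.2))⁻¹) fun _ _ _ => rfl

/-- ★★ **The gauge average of a polynomial observable on the torus is a polynomial observable.**
[folklore] -/
theorem orbitAverage_gaugeTransform_mem_polyFunctions [NeZero L] {f : GaugeConfig d L G → ℝ}
    (hf : f ∈ polyFunctions (ι := Edge d L) r) :
    orbitAverage (gaugeTransform (d := d) (L := L) (G := G)) f ∈ polyFunctions (ι := Edge d L) r :=
  orbitAverage_mem_polyFunctions r gaugeTransform_action.2 (gaugeTransform_hgen r) hf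

omit [CompactSpace G] [MeasurableSpace G] [BorelSpace G] [SecondCountableTopology G] in
/-- The `ℤ^d` gauge action has the local linear form `(U^g)_e = g(x) U_e g(x+eᵢ)⁻¹`. [folklore] -/
theorem gaugeTransformZd_hgen :
    ∀ g ∈ entryGens (ι := ZdEdge d) r, ∃ W : Submodule ℝ C(LGConfig d G, ℝ), W.FG ∧
      W ≤ Subalgebra.toSubmodule (polyAlgebra (ι := ZdEdge d) r) ∧ g ∈ W ∧
      ∀ h : (Fin d → ℤ) → G, W.map (ContinuousMap.compRightAlgHom ℝ ℝ
        (actCM (gaugeTransformZd (d := d) (G := G)) gaugeTransformZd_action.2 h)).toLinearMap ≤ W :=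
  exists_fg_invariant_of_local r gaugeTransformZd_action.2 (fun h e => h e.1)
    (fun h e => (h (e.1 + Pi.single e.2 1))⁻¹) fun _ _ _ => rfl

/-- ★★ **The gauge average of a polynomial observable on `ℤ^d` is a polynomial observable.**
[folklore] -/
theorem orbitAverage_gaugeTransformZd_mem_polyFunctions {f : LGConfig d G → ℝ}
    (hf : f ∈ polyFunctions (ι := ZdEdge d) r) :
    orbitAverage (gaugeTransformZd (d := d) (G := G)) f ∈ polyFunctions (ι := ZdEdge d) r :=
  orbitAverage_mem_polyFunctions r gaugeTransformZd_action.2 (gaugeTransformZd_hgen r) hf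

end Gauge

end Summit.QuantumFields.GaugeBoot

end
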